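import Mathlib.Analysis.Calculus.InverseFunctionTheorem.Deriv
import Mathlib.Analysis.Complex.CauchyIntegral
import Mathlib.Analysis.Analytic.IsolatedZeros

/-!
# The inverse of a univalent holomorphic function is holomorphic

Crux `WitnessCharge` (item stmt-SmoothPoincare4-7824, route route-SmoothPoincare4-SullivanDual),
line `Sketch`, stub `helper_holoInverse`.

Let `Z` be holomorphic and injective on an open set `U ⊆ ℂ` with zero-free derivative. Then the
image `Z '' U` is open and the set-theoretic inverse `Function.invFunOn Z U` is holomorphic (hence
continuous) on `Z '' U`, maps `Z '' U` into `U`, and is a left inverse of `Z` on `U`.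

Proof (inverse function theorem, pointwise): at `ξ ∈ U` the function `Z` is analytic
(`DifferentiableOn.analyticAt`), so it has a strict derivative `deriv Z ξ ≠ 0`
(`AnalyticAt.hasStrictDerivAt`); hence `map Z (𝓝 ξ) = 𝓝 (Z ξ)`
(`HasStrictDerivAt.map_nhds_eq`), which gives `Z '' U ∈ 𝓝 (Z ξ)` (openness of the image), and
any local left inverse of `Z` near `ξ` — in particular `Function.invFunOn Z U`, a left inverse on
the neighbourhood `U` of `ξ` by injectivity (`Set.InjOn.leftInvOn_invFunOn`) — has strict
derivative `(deriv Z ξ)⁻¹` at `Z ξ` (`HasStrictDerivAt.to_local_left_inverse`). (The same argument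
appears in the project library as `Complex.differentiableOn_invFunOn_image`,
`Literature/Analysis/Complex/RiemannMapping.lean`; it is repeated here to keep this helper on
Mathlib-only imports.)
-/

noncomputable section

set_option linter.dupNamespace false

open Set Filter Topology Metric

namespace Summit.SmoothPoincare4.SmoothPoincare4.Theorems.WitnessCharge.PencilIncompleteness

/-- **The inverse of a univalent function is holomorphic.** If `Z : ℂ → ℂ` is holomorphic and
injective on an open set `U` with `deriv Z ξ ≠ 0` for all `ξ ∈ U`, then `Z '' U` is open, the
inverse `Function.invFunOn Z U` is complex differentiable and continuous on `Z '' U`, maps `Z '' U`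
into `U`, and satisfies `Function.invFunOn Z U (Z ξ) = ξ` for `ξ ∈ U`. Proof: pointwise inverse
function theorem (`HasStrictDerivAt.map_nhds_eq`, `HasStrictDerivAt.to_local_left_inverse`)
applied to the left inverse `Function.invFunOn Z U` (`Set.InjOn.leftInvOn_invFunOn`). -/
theorem helper_holoInverse :
    ∀ (Z : ℂ → ℂ) (U : Set ℂ), IsOpen U → DifferentiableOn ℂ Z U → InjOn Z U →
      (∀ ξ ∈ U, deriv Z ξ ≠ 0) →
      IsOpen (Z '' U) ∧ DifferentiableOn ℂ (Function.invFunOn Z U) (Z '' U) ∧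
        ContinuousOn (Function.invFunOn Z U) (Z '' U) ∧
        MapsTo (Function.invFunOn Z U) (Z '' U) U ∧
        ∀ ξ ∈ U, Function.invFunOn Z U (Z ξ) = ξ := by
  intro Z U hU hZ hinj hZ'
  -- `invFunOn Z U` is a left inverse of `Z` on `U` and maps the image back into `U`
  have hleft : ∀ ξ ∈ U, Function.invFunOn Z U (Z ξ) = ξ := fun ξ hξ =>
    hinj.leftInvOn_invFunOn hξ
  have hmaps : MapsTo (Function.invFunOn Z U) (Z '' U) U := by
    rintro _ ⟨ξ, hξ, rfl⟩
    exact Function.invFunOn_apply_mem hξ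
  -- `Z` has the strict derivative `deriv Z ξ` at every `ξ ∈ U`
  have hstrict : ∀ ξ ∈ U, HasStrictDerivAt Z (deriv Z ξ) ξ := fun ξ hξ =>
    (hZ.analyticAt (hU.mem_nhds hξ)).hasStrictDerivAt
  -- the image is open: `Z` maps neighbourhoods of `ξ` onto neighbourhoods of `Z ξ`
  have hopen : IsOpen (Z '' U) := by
    refine isOpen_iff_mem_nhds.2 ?_
    rintro _ ⟨ξ, hξ, rfl⟩
    rw [← (hstrict ξ hξ).map_nhds_eq (hZ' ξ hξ)]
    exact image_mem_map (hU.mem_nhds hξ)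
  -- the inverse has the strict derivative `(deriv Z ξ)⁻¹` at `Z ξ`
  have hderiv : ∀ ξ ∈ U, HasStrictDerivAt (Function.invFunOn Z U) (deriv Z ξ)⁻¹ (Z ξ) :=
    fun ξ hξ => (hstrict ξ hξ).to_local_left_inverse (hZ' ξ hξ) <| by
      filter_upwards [hU.mem_nhds hξ] with x hx using hleft x hx
  have hdiff : DifferentiableOn ℂ (Function.invFunOn Z U) (Z '' U) := by
    rintro _ ⟨ξ, hξ, rfl⟩
    exact (hderiv ξ hξ).hasDerivAt.differentiableAt.differentiableWithinAt
  exact ⟨hopen, hdiff, hdiff.continuousOn, hmaps, hleft⟩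

end Summit.SmoothPoincare4.SmoothPoincare4.Theorems.WitnessCharge.PencilIncompleteness
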